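import Mathlib
import HarnessLib
import Summits.Ventures.LatticeQCDFlow.Scoring.KArmPooledAfterHomogeneity
import Summits.Ventures.LatticeQCDFlow.Scoring.KArmHomogeneityInProbability

/-!
# POOLING AFTER THE HOMOGENEITY TEST WITH ERROR BARS CONSISTENT ONLY IN PROBABILITY: THE SAME
# JOINT LIMIT, THE SAME CALIBRATION, THE SAME CONDITIONAL CALIBRATION

HONEST FRAMING: exact (Metropolis-corrected) sampling algorithms for lattice gauge theory;
figures of merit are autocorrelation/cost numbers at stated couplings and volumes; no
continuum-physics claim.

Venture `LatticeQCDFlow` (cell pub-lqcd), topic `Scoring`; FANOUT row 4 (`s0-u1-b`, GEN-35).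
NEW WORK of the cell (classical large-sample statistics; our formalisation), no definition,
nothing cited as a fact.

WHY (row 4).  `Scoring/KArmPooledEstimate` / `Scoring/KArmPooledAfterHomogeneity` assume each code's
scaled squared error bar converges ALMOST SURELY (`k·V̂ₖ^r → s_r`).  The error bars the cell prints
(batch means, Γ-method windows) are consistent only IN PROBABILITY.  As
`Scoring/KArmHomogeneityInProbability` did for the test alone, this file re-proves the pooled-side
statements under `k·V̂ₖ^r → s_r` in `P_r`-measure: the pair
`((m̂ₖ − a)²·Σ_r (V̂ₖ^r)⁻¹, Qₖ)` still converges in distribution to the pair of Gaussian functionals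
(**`kArm_pooled_homogeneity_joint_tendsto_of_tendstoInMeasure`** — Slutsky with the clamped pair
functional; the printed pair differs from the clamped one only on `⋃_r {k·V̂ₖ^r ≤ m₀}`, an event of
vanishing probability), hence under equal targets the pooled interval is calibrated
(**`kArm_pooled_coverage_of_tendstoInMeasure`**), the joint probability with the test decision tends
to the product (**`kArm_pooled_homogeneity_coverage_of_tendstoInMeasure`**) and the conditional
coverage given `Qₖ ≤ c` (`c > 0`) tends to the nominal `N(0,1)([−|z|,|z|])`
(**`kArm_pooled_coverage_conditional_of_tendstoInMeasure`**).

NOT CLAIMED: anything at finite `k`; dependent codes; drifts (see `Scoring/KArmPooledUnderDrift`,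
whose proofs go through verbatim with in-measure bars); numbers.
-/

open MeasureTheory ProbabilityTheory Filter Topology Finset

namespace Summit.Ventures.LatticeQCDFlow.Scoring

open Set WithLp

section InMeasure

variable {n : ℕ} {Ωs : Fin (n + 2) → Type*} [∀ r, MeasurableSpace (Ωs r)]
  {Ps : (r : Fin (n + 2)) → Measure (Ωs r)} [∀ r, IsProbabilityMeasure (Ps r)]
variable {Ω' : Type*} [MeasurableSpace Ω'] {P' : Measure Ω'} [IsProbabilityMeasure P']

set_option maxHeartbeats 400000 in
/-- **THE PAIR (POOLED STATISTIC, HOMOGENEITY STATISTIC) CONVERGES JOINTLY — IN-MEASURE ERROR BARS.**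
`R = n + 2 ≥ 2` codes, `√k(Sₖ^r − a) ⇒ Z_r` (independent measurable limits), `k·V̂ₖ^r → s_r > 0` in
`P_r`-measure.  Then `((m̂ₖ − a)²·Σ_r (V̂ₖ^r)⁻¹, Σ_r (Sₖ^r − m̂ₖ)²/V̂ₖ^r)` converges in distribution on
`⊗_r P_r` to `((Σ_r Z_r/s_r)²/(Σ_r s_r⁻¹), Σ_r (Z_r − m̂(Z))²/s_r)`. [ours] -/
theorem kArm_pooled_homogeneity_joint_tendsto_of_tendstoInMeasure
    {S V : (r : Fin (n + 2)) → ℕ → Ωs r → ℝ} {a : ℝ}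
    {s : Fin (n + 2) → ℝ} {Z : Fin (n + 2) → Ω' → ℝ} (hs : ∀ r, 0 < s r)
    (hSm : ∀ r k, Measurable (S r k)) (hVm : ∀ r k, Measurable (V r k))
    (hclt : ∀ r, TendstoInDistribution (fun (k : ℕ) ω => Real.sqrt k * (S r k ω - a)) atTop (Z r)
      (fun _ => Ps r) P')
    (hZm : ∀ r, Measurable (Z r)) (hind : iIndepFun Z P')
    (hV : ∀ r, TendstoInMeasure (Ps r) (fun (k : ℕ) ω => (k : ℝ) * V r k ω) atTop (fun _ => s r)) :
    TendstoInDistribution (fun (k : ℕ) (ω : (r : Fin (n + 2)) → Ωs r) =>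
        (((∑ j, S j k (ω j) / V j k (ω j)) / (∑ j, (V j k (ω j))⁻¹) - a) ^ 2 * (∑ j, (V j k (ω j))⁻¹),
          ∑ r, (S r k (ω r) - (∑ j, S j k (ω j) / V j k (ω j)) / (∑ j, (V j k (ω j))⁻¹)) ^ 2
            / V r k (ω r)))
      atTop (fun ω' => ((∑ j, Z j ω' / s j) ^ 2 / (∑ j, (s j)⁻¹),
        ∑ r, (Z r ω' - (∑ j, Z j ω' / s j) / (∑ j, (s j)⁻¹)) ^ 2 / s r))
      (fun _ => Measure.pi Ps) P' := by
  -- the clamp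
  set m₀ : ℝ := (Finset.univ.inf' Finset.univ_nonempty s) / 2 with hm₀
  have hinf : 0 < Finset.univ.inf' Finset.univ_nonempty s :=
    (Finset.lt_inf'_iff _).2 fun r _ => hs r
  have hm0 : 0 < m₀ := by rw [hm₀]; exact half_pos hinf
  have hm_le : ∀ r, m₀ < s r := fun r => by
    have : Finset.univ.inf' Finset.univ_nonempty s ≤ s r := Finset.inf'_le _ (Finset.mem_univ r)
    rw [hm₀]; linarith
  -- Step 1: joint convergence of the scaled columns; the error-bar vector in measure
  have hXm : ∀ r (k : ℕ), Measurable fun ω : Ωs r => Real.sqrt (k : ℝ) * (S r k ω - a) :=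
    fun r k => ((hSm r k).sub_const a).const_mul _
  have hY := CardConsistency.tendstoInDistribution_replicas (Ps := Ps) hclt hXm hZm hind
  have hWm : ∀ k : ℕ, Measurable fun (ω : (r : Fin (n + 2)) → Ωs r) (r : Fin (n + 2)) =>
      ((k : ℕ) : ℝ) * V r k (ω r) :=
    fun k => measurable_pi_lambda _ fun r => ((hVm r k).comp (measurable_pi_apply r)).const_mul _
  have hWm' : ∀ k : ℕ, Measurable fun (ω : (r : Fin (n + 2)) → Ωs r) =>
      (toLp 2 (fun r : Fin (n + 2) => ((k : ℕ) : ℝ) * V r k (ω r)) : EuclideanSpace ℝ (Fin (n + 2))) :=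
    fun k => (WithLp.measurable_toLp 2 _).comp (hWm k)
  have hVpi : ∀ r, TendstoInMeasure (Measure.pi Ps)
      (fun (k : ℕ) (ω : (i : Fin (n + 2)) → Ωs i) => (k : ℝ) * V r k (ω r)) atTop (fun _ => s r) := by
    intro r
    have h1 := hV r
    rw [tendstoInMeasure_iff_norm] at h1 ⊢
    intro ε hε
    refine (h1 ε hε).congr fun k => ?_
    have hA : MeasurableSet {x : Ωs r | ε ≤ ‖(k : ℝ) * V r k x - s r‖} :=
      measurableSet_le measurable_const (((hVm r k).const_mul _).sub_const _).norm
    exact (pi_measure_setOf_eval (Ps := Ps) r hA).symm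
  have hW : TendstoInMeasure (Measure.pi Ps) (fun (k : ℕ) (ω : (r : Fin (n + 2)) → Ωs r) =>
      (toLp 2 (fun r : Fin (n + 2) => ((k : ℕ) : ℝ) * V r k (ω r)) : EuclideanSpace ℝ (Fin (n + 2))))
      atTop (fun _ => (toLp 2 s : EuclideanSpace ℝ (Fin (n + 2)))) :=
    tendstoInMeasure_euclidean_of_forall (P := Measure.pi Ps)
      (X := fun (k : ℕ) (ω : (r : Fin (n + 2)) → Ωs r) (r : Fin (n + 2)) => ((k : ℕ) : ℝ) * V r k (ω r))
      (c := s) hVpi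
  -- Step 2: Slutsky with the clamped pair functional
  set G : EuclideanSpace ℝ (Fin (n + 2)) × EuclideanSpace ℝ (Fin (n + 2)) → ℝ := fun p =>
    (∑ j, p.1 j / max (p.2 j) m₀) ^ 2 / (∑ j, (max (p.2 j) m₀)⁻¹) with hG
  set F : EuclideanSpace ℝ (Fin (n + 2)) × EuclideanSpace ℝ (Fin (n + 2)) → ℝ := fun p =>
    ∑ r, (p.1 r - (∑ j, p.1 j / max (p.2 j) m₀) / (∑ j, (max (p.2 j) m₀)⁻¹)) ^ 2 / max (p.2 r) m₀
    with hF
  have hHc : Continuous fun p => (G p, F p) :=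
    (continuous_pooledClamp (R := n + 2) hm0).prodMk (continuous_homogeneityClamp (R := n + 2) hm0)
  have hsl := hY.continuous_comp_prodMk_of_tendstoInMeasure_const hHc hW (fun k => (hWm' k).aemeasurable)
  have hlim : (fun ω' => (G ((toLp 2 fun r => Z r ω' : EuclideanSpace ℝ (Fin (n + 2))),
        (toLp 2 s : EuclideanSpace ℝ (Fin (n + 2)))),
        F ((toLp 2 fun r => Z r ω' : EuclideanSpace ℝ (Fin (n + 2))),
        (toLp 2 s : EuclideanSpace ℝ (Fin (n + 2))))))
      = fun ω' => ((∑ j, Z j ω' / s j) ^ 2 / (∑ j, (s j)⁻¹),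
        ∑ r, (Z r ω' - (∑ j, Z j ω' / s j) / (∑ j, (s j)⁻¹)) ^ 2 / s r) := by
    funext ω'
    simp only [hG, hF, max_eq_left (hm_le _).le]
  rw [hlim] at hsl
  -- Step 3: the printed pair differs from the clamped pair only on `⋃_r {k V_r ≤ m₀}`
  have h1m : ∀ (k : ℕ) r, Measurable fun ω : (r : Fin (n + 2)) → Ωs r => S r k (ω r) :=
    fun k r => (hSm r k).comp (measurable_pi_apply r)
  have h2m : ∀ (k : ℕ) r, Measurable fun ω : (r : Fin (n + 2)) → Ωs r => V r k (ω r) :=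
    fun k r => (hVm r k).comp (measurable_pi_apply r)
  have hTm : ∀ k : ℕ, Measurable fun ω : (r : Fin (n + 2)) → Ωs r =>
      (((∑ j, S j k (ω j) / V j k (ω j)) / (∑ j, (V j k (ω j))⁻¹) - a) ^ 2 * (∑ j, (V j k (ω j))⁻¹),
        ∑ r, (S r k (ω r) - (∑ j, S j k (ω j) / V j k (ω j)) / (∑ j, (V j k (ω j))⁻¹)) ^ 2
          / V r k (ω r)) := by
    intro k
    have := h1m k
    have := h2m k
    exact (by fun_prop : Measurable fun ω : (r : Fin (n + 2)) → Ωs r =>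
      ((∑ j, S j k (ω j) / V j k (ω j)) / (∑ j, (V j k (ω j))⁻¹) - a) ^ 2 * (∑ j, (V j k (ω j))⁻¹)).prodMk
      (by fun_prop)
  have hagree : ∀ (k : ℕ), 1 ≤ k → ∀ ω : (r : Fin (n + 2)) → Ωs r,
      (∀ r, m₀ < ((k : ℕ) : ℝ) * V r k (ω r)) →
      ((((∑ j, S j k (ω j) / V j k (ω j)) / (∑ j, (V j k (ω j))⁻¹) - a) ^ 2 * (∑ j, (V j k (ω j))⁻¹),
        ∑ r, (S r k (ω r) - (∑ j, S j k (ω j) / V j k (ω j)) / (∑ j, (V j k (ω j))⁻¹)) ^ 2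
          / V r k (ω r)) : ℝ × ℝ)
        = (G ((toLp 2 fun r => Real.sqrt (k : ℝ) * (S r k (ω r) - a) : EuclideanSpace ℝ (Fin (n + 2))),
            (toLp 2 (fun r : Fin (n + 2) => ((k : ℕ) : ℝ) * V r k (ω r)) : EuclideanSpace ℝ (Fin (n + 2)))),
           F ((toLp 2 fun r => Real.sqrt (k : ℝ) * (S r k (ω r) - a) : EuclideanSpace ℝ (Fin (n + 2))),
            (toLp 2 (fun r : Fin (n + 2) => ((k : ℕ) : ℝ) * V r k (ω r)) : EuclideanSpace ℝ (Fin (n + 2))))) := by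
    intro k hk1 ω hk
    have hVpos : ∀ r, 0 < V r k (ω r) := fun r => by
      have := hk r
      have hkpos : (0 : ℝ) < k := by exact_mod_cast hk1
      nlinarith [hm0]
    simp only [hG, hF, max_eq_left (hk _).le]
    rw [homogeneity_statistic_scale hk1 (fun r => S r k (ω r)) (fun r => V r k (ω r)) hVpos a,
      pooled_statistic_scale hk1 (fun r => S r k (ω r)) (fun r => V r k (ω r)) hVpos a]
  have hdev : TendstoInMeasure (Measure.pi Ps) ((fun (k : ℕ) (ω : (r : Fin (n + 2)) → Ωs r) =>
      ((((∑ j, S j k (ω j) / V j k (ω j)) / (∑ j, (V j k (ω j))⁻¹) - a) ^ 2 * (∑ j, (V j k (ω j))⁻¹),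
        ∑ r, (S r k (ω r) - (∑ j, S j k (ω j) / V j k (ω j)) / (∑ j, (V j k (ω j))⁻¹)) ^ 2
          / V r k (ω r)) : ℝ × ℝ)) - fun (k : ℕ) ω =>
      (G ((toLp 2 fun r => Real.sqrt (k : ℝ) * (S r k (ω r) - a) : EuclideanSpace ℝ (Fin (n + 2))),
          (toLp 2 (fun r : Fin (n + 2) => ((k : ℕ) : ℝ) * V r k (ω r)) : EuclideanSpace ℝ (Fin (n + 2)))),
        F ((toLp 2 fun r => Real.sqrt (k : ℝ) * (S r k (ω r) - a) : EuclideanSpace ℝ (Fin (n + 2))),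
          (toLp 2 (fun r : Fin (n + 2) => ((k : ℕ) : ℝ) * V r k (ω r)) : EuclideanSpace ℝ (Fin (n + 2))))))
      atTop 0 := by
    rw [tendstoInMeasure_iff_norm]
    intro ε hε
    have hbad : ∀ r, Tendsto (fun k : ℕ => Measure.pi Ps
        {ω : (i : Fin (n + 2)) → Ωs i | ((k : ℕ) : ℝ) * V r k (ω r) ≤ m₀}) atTop (𝓝 0) :=
      fun r => tendsto_measure_le_of_tendstoInMeasure (hm_le r) (hVpi r)
    have hsum : Tendsto (fun k : ℕ => ∑ r : Fin (n + 2), Measure.pi Ps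
        {ω : (i : Fin (n + 2)) → Ωs i | ((k : ℕ) : ℝ) * V r k (ω r) ≤ m₀}) atTop (𝓝 0) := by
      have := tendsto_finsetSum (Finset.univ : Finset (Fin (n + 2))) fun r _ => hbad r
      simpa using this
    refine tendsto_of_tendsto_of_tendsto_of_le_of_le' tendsto_const_nhds hsum
      (Eventually.of_forall fun k => zero_le) ?_
    filter_upwards [eventually_ge_atTop 1] with k hk1
    refine (measure_mono fun ω hω => ?_).trans (measure_iUnion_fintype_le _ _)
    simp only [Set.mem_setOf_eq, Pi.sub_apply, Pi.zero_apply, sub_zero] at hω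
    simp only [Set.mem_iUnion, Set.mem_setOf_eq]
    by_contra hall
    simp only [not_exists, not_le] at hall
    have heq := hagree k hk1 ω hall
    rw [heq, sub_self, norm_zero] at hω
    exact absurd hω (not_le.2 hε)
  exact tendstoInDistribution_of_tendstoInMeasure_sub _ _ hsl hdev (fun k => (hTm k).aemeasurable)

/-- **THE POOLED INTERVAL IS CALIBRATED — IN-MEASURE ERROR BARS.**  Equal targets,
`√k(Sₖ^r − a) ⇒ N(0, s_r)` independent, `k·V̂ₖ^r → s_r > 0` in probability:
`P((m̂ₖ − a)²·Σ_r (V̂ₖ^r)⁻¹ ≤ z²) → N(0,1)([−|z|, |z|])`. [ours] -/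
theorem kArm_pooled_coverage_of_tendstoInMeasure {S V : (r : Fin (n + 2)) → ℕ → Ωs r → ℝ} {a : ℝ}
    {s : Fin (n + 2) → ℝ} {Z : Fin (n + 2) → Ω' → ℝ} (hs : ∀ r, 0 < s r)
    (hSm : ∀ r k, Measurable (S r k)) (hVm : ∀ r k, Measurable (V r k))
    (hclt : ∀ r, TendstoInDistribution (fun (k : ℕ) ω => Real.sqrt k * (S r k ω - a)) atTop (Z r)
      (fun _ => Ps r) P')
    (hZm : ∀ r, Measurable (Z r)) (hZ : ∀ r, HasLaw (Z r) (gaussianReal 0 (s r).toNNReal) P')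
    (hind : iIndepFun Z P')
    (hV : ∀ r, TendstoInMeasure (Ps r) (fun (k : ℕ) ω => (k : ℝ) * V r k ω) atTop (fun _ => s r))
    (z : ℝ) :
    Tendsto (fun k : ℕ => (Measure.pi Ps).real {ω : (r : Fin (n + 2)) → Ωs r |
        ((∑ j, S j k (ω j) / V j k (ω j)) / (∑ j, (V j k (ω j))⁻¹) - a) ^ 2 * (∑ j, (V j k (ω j))⁻¹)
          ≤ z ^ 2})
      atTop (𝓝 ((gaussianReal 0 1).real (Icc (-|z|) |z|))) := by
  have hpair := kArm_pooled_homogeneity_joint_tendsto_of_tendstoInMeasure hs hSm hVm hclt hZm hind hV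
  have hfst := hpair.continuous_comp continuous_fst
  have hLm : Measurable fun ω' => (∑ j, Z j ω' / s j) ^ 2 / (∑ j, (s j)⁻¹) := by fun_prop
  have hatom : P' {ω' | (∑ j, Z j ω' / s j) ^ 2 / (∑ j, (s j)⁻¹) = z ^ 2} = 0 := by
    have h := measure_pooled_limit_sq_preimage_eq hs hZm hZ hind (measurableSet_singleton (z ^ 2))
    simp only [Set.mem_singleton_iff] at h
    rw [h]
    have hsub : {t : ℝ | t ^ 2 = z ^ 2} ⊆ {z, -z} := by
      intro t ht
      simp only [Set.mem_setOf_eq] at ht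
      rcases sq_eq_sq_iff_eq_or_eq_neg.1 ht with h1 | h1
      · simp [h1]
      · simp [h1]
    exact measure_mono_null hsub (by
      haveI := nullSingletonClass_gaussianReal (μ := 0) one_ne_zero
      exact (Set.toFinite _).measure_zero _)
  have hfr : (P'.map fun ω' => (∑ j, Z j ω' / s j) ^ 2 / (∑ j, (s j)⁻¹)) (frontier (Iic (z ^ 2))) = 0 := by
    rw [frontier_Iic, Measure.map_apply hLm (measurableSet_singleton _)]
    exact hatom
  have hconv : Tendsto (fun k : ℕ => (Measure.pi Ps).real {ω : (r : Fin (n + 2)) → Ωs r |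
      ((∑ j, S j k (ω j) / V j k (ω j)) / (∑ j, (V j k (ω j))⁻¹) - a) ^ 2 * (∑ j, (V j k (ω j))⁻¹)
        ≤ z ^ 2}) atTop (𝓝 (P'.real {ω' | (∑ j, Z j ω' / s j) ^ 2 / (∑ j, (s j)⁻¹) ≤ z ^ 2})) :=
    CardConsistency.tendsto_measureReal_preimage_of_tendstoInDistribution hfst measurableSet_Iic hfr
  have hlimit : P'.real {ω' | (∑ j, Z j ω' / s j) ^ 2 / (∑ j, (s j)⁻¹) ≤ z ^ 2}
      = (gaussianReal 0 1).real (Icc (-|z|) |z|) := by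
    simp only [measureReal_def]
    congr 1
    have h := measure_pooled_limit_sq_preimage_eq hs hZm hZ hind (measurableSet_Iic (a := z ^ 2))
    simp only [Set.mem_Iic] at h
    rw [h, setOf_sq_le_sq_eq_Icc]
  rw [hlimit] at hconv
  exact hconv

/-- **JOINTLY WITH THE TEST — IN-MEASURE ERROR BARS**: equal targets, every `z`, `c`:
`P((m̂ₖ − a)²·Σ_r (V̂ₖ^r)⁻¹ ≤ z² ∧ Qₖ ≤ c) → N(0,1)([−|z|,|z|]) · N(0,1)^{⊗R}{Σ_{r≠0} z_r² ≤ c}`. [ours] -/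
theorem kArm_pooled_homogeneity_coverage_of_tendstoInMeasure
    {S V : (r : Fin (n + 2)) → ℕ → Ωs r → ℝ} {a : ℝ}
    {s : Fin (n + 2) → ℝ} {Z : Fin (n + 2) → Ω' → ℝ} (hs : ∀ r, 0 < s r)
    (hSm : ∀ r k, Measurable (S r k)) (hVm : ∀ r k, Measurable (V r k))
    (hclt : ∀ r, TendstoInDistribution (fun (k : ℕ) ω => Real.sqrt k * (S r k ω - a)) atTop (Z r)
      (fun _ => Ps r) P')
    (hZm : ∀ r, Measurable (Z r)) (hZ : ∀ r, HasLaw (Z r) (gaussianReal 0 (s r).toNNReal) P')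
    (hind : iIndepFun Z P')
    (hV : ∀ r, TendstoInMeasure (Ps r) (fun (k : ℕ) ω => (k : ℝ) * V r k ω) atTop (fun _ => s r))
    (z c : ℝ) :
    Tendsto (fun k : ℕ => (Measure.pi Ps).real ({ω : (r : Fin (n + 2)) → Ωs r |
        ((∑ j, S j k (ω j) / V j k (ω j)) / (∑ j, (V j k (ω j))⁻¹) - a) ^ 2 * (∑ j, (V j k (ω j))⁻¹)
          ≤ z ^ 2} ∩ {ω | ∑ r, (S r k (ω r) - (∑ j, S j k (ω j) / V j k (ω j)) / (∑ j, (V j k (ω j))⁻¹)) ^ 2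
          / V r k (ω r) ≤ c}))
      atTop (𝓝 ((gaussianReal 0 1).real (Icc (-|z|) |z|)
        * (Measure.pi fun _ : Fin (n + 2) => gaussianReal 0 1).real
          {x : Fin (n + 2) → ℝ | ∑ r ∈ univ.erase 0, x r ^ 2 ≤ c})) := by
  have hpair := kArm_pooled_homogeneity_joint_tendsto_of_tendstoInMeasure hs hSm hVm hclt hZm hind hV
  set L : Ω' → ℝ × ℝ := fun ω' => ((∑ j, Z j ω' / s j) ^ 2 / (∑ j, (s j)⁻¹),
    ∑ r, (Z r ω' - (∑ j, Z j ω' / s j) / (∑ j, (s j)⁻¹)) ^ 2 / s r) with hL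
  have hLm : Measurable L := by
    simp only [hL]
    fun_prop
  have hW : 0 < ∑ j, (s j)⁻¹ := Finset.sum_pos (fun j _ => inv_pos.2 (hs j)) Finset.univ_nonempty
  have h1 : P' {ω' | (∑ j, Z j ω' / s j) ^ 2 / (∑ j, (s j)⁻¹) = z ^ 2} = 0 := by
    have h := measure_pooled_limit_sq_preimage_eq hs hZm hZ hind (measurableSet_singleton (z ^ 2))
    simp only [Set.mem_singleton_iff] at h
    rw [h]
    have hsub : {t : ℝ | t ^ 2 = z ^ 2} ⊆ {z, -z} := by
      intro t ht
      simp only [Set.mem_setOf_eq] at ht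
      rcases sq_eq_sq_iff_eq_or_eq_neg.1 ht with h1 | h1
      · simp [h1]
      · simp [h1]
    exact measure_mono_null hsub (by
      haveI := nullSingletonClass_gaussianReal (μ := 0) one_ne_zero
      exact (Set.toFinite _).measure_zero _)
  have h2 : P' {ω' | ∑ r, (Z r ω' - (∑ j, Z j ω' / s j) / (∑ j, (s j)⁻¹)) ^ 2 / s r = c} = 0 :=
    measure_homogeneity_limit_levelSet_eq_zero hs hZm hZ hind c
  have hfr : (P'.map L) (frontier (Iic (z ^ 2) ×ˢ Iic c)) = 0 := by
    refine measure_mono_null (frontier_Iic_prod_Iic_subset (z ^ 2) c) ?_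
    rw [Measure.map_apply hLm ((measurableSet_eq_fun measurable_fst measurable_const).union
      (measurableSet_eq_fun measurable_snd measurable_const))]
    exact measure_union_null h1 h2
  have hconv := tendsto_measureReal_preimage_of_tendstoInDistribution_prod hpair
    (measurableSet_Iic.prod measurableSet_Iic) hfr
  have hlimit : P'.real (L ⁻¹' (Iic (z ^ 2) ×ˢ Iic c))
      = (gaussianReal 0 1).real (Icc (-|z|) |z|)
        * (Measure.pi fun _ : Fin (n + 2) => gaussianReal 0 1).real
          {x : Fin (n + 2) → ℝ | ∑ r ∈ univ.erase 0, x r ^ 2 ≤ c} := by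
    have hT : MeasurableSet {t : ℝ | t ^ 2 ≤ z ^ 2} :=
      measurableSet_le (by fun_prop) measurable_const
    have h := measure_pooled_inter_homogeneity_limit_eq hs hZm hZ hind hT (measurableSet_Iic (a := c))
    have e : L ⁻¹' (Iic (z ^ 2) ×ˢ Iic c)
        = {ω' | (∑ j, Z j ω' / s j) / Real.sqrt (∑ j, (s j)⁻¹) ∈ {t : ℝ | t ^ 2 ≤ z ^ 2}}
          ∩ {ω' | ∑ r, (Z r ω' - (∑ j, Z j ω' / s j) / (∑ j, (s j)⁻¹)) ^ 2 / s r ∈ Iic c} := by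
      ext ω'
      simp only [hL, Set.mem_preimage, Set.mem_prod, Set.mem_Iic, Set.mem_inter_iff, Set.mem_setOf_eq,
        div_pow, Real.sq_sqrt hW.le]
    rw [measureReal_def, e, h, setOf_sq_le_sq_eq_Icc, ENNReal.toReal_mul, measureReal_def, measureReal_def]
    simp only [Set.mem_Iic]
  rw [hlimit] at hconv
  exact hconv

/-- **CONDITIONALLY ON PASSING THE TEST — IN-MEASURE ERROR BARS**: equal targets, `c > 0`: the
conditional coverage probability of the pooled interval given `Qₖ ≤ c` tends to `N(0,1)([−|z|,|z|])`.
[ours] -/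
theorem kArm_pooled_coverage_conditional_of_tendstoInMeasure
    {S V : (r : Fin (n + 2)) → ℕ → Ωs r → ℝ} {a : ℝ}
    {s : Fin (n + 2) → ℝ} {Z : Fin (n + 2) → Ω' → ℝ} (hs : ∀ r, 0 < s r)
    (hSm : ∀ r k, Measurable (S r k)) (hVm : ∀ r k, Measurable (V r k))
    (hclt : ∀ r, TendstoInDistribution (fun (k : ℕ) ω => Real.sqrt k * (S r k ω - a)) atTop (Z r)
      (fun _ => Ps r) P')
    (hZm : ∀ r, Measurable (Z r)) (hZ : ∀ r, HasLaw (Z r) (gaussianReal 0 (s r).toNNReal) P')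
    (hind : iIndepFun Z P')
    (hV : ∀ r, TendstoInMeasure (Ps r) (fun (k : ℕ) ω => (k : ℝ) * V r k ω) atTop (fun _ => s r))
    (z : ℝ) {c : ℝ} (hc : 0 < c) :
    Tendsto (fun k : ℕ => (Measure.pi Ps).real ({ω : (r : Fin (n + 2)) → Ωs r |
        ((∑ j, S j k (ω j) / V j k (ω j)) / (∑ j, (V j k (ω j))⁻¹) - a) ^ 2 * (∑ j, (V j k (ω j))⁻¹)
          ≤ z ^ 2} ∩ {ω | ∑ r, (S r k (ω r) - (∑ j, S j k (ω j) / V j k (ω j)) / (∑ j, (V j k (ω j))⁻¹)) ^ 2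
          / V r k (ω r) ≤ c})
        / (Measure.pi Ps).real {ω : (r : Fin (n + 2)) → Ωs r |
          ∑ r, (S r k (ω r) - (∑ j, S j k (ω j) / V j k (ω j)) / (∑ j, (V j k (ω j))⁻¹)) ^ 2
            / V r k (ω r) ≤ c})
      atTop (𝓝 ((gaussianReal 0 1).real (Icc (-|z|) |z|))) := by
  have hjoint := kArm_pooled_homogeneity_coverage_of_tendstoInMeasure hs hSm hVm hclt hZm hZ hind hV z c
  have htest := kArm_homogeneity_coverage_of_tendstoInMeasure hs hSm hVm hclt hZm hZ hind hV c
  have hpos := pi_gaussianReal_sumSqErase_le_pos (ι := Fin (n + 2)) 0 hc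
  have hdiv := hjoint.div htest hpos.ne'
  rw [mul_div_cancel_right₀ _ hpos.ne'] at hdiv
  exact hdiv

end InMeasure

end Summit.Ventures.LatticeQCDFlow.Scoring
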